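import Literature.Computability.AlgebraicComplexity.BurgisserZeroDimSlice
import Literature.Computability.AlgebraicComplexity.BurgisserPerturbedCharpolyHeight
import Literature.Computability.AlgebraicComplexity.BurgisserLagrangeHeights
import Literature.Computability.AlgebraicComplexity.BurgisserReductionModPrimesProofs
import Mathlib.FieldTheory.PrimitiveElement
import Mathlib.FieldTheory.IntermediateField.Adjoin.Basic
import HarnessLib

/-!
# Proof of Bürgisser's Theorem 4.5 (algebraic solutions of small degree and height)

Topic: `Literature/Computability/AlgebraicComplexity`. This file DISCHARGES the named fact
`algebraicSolution_height_bound` (`BurgisserReductionModPrimes.lean`; Bürgisser, *Cook's versus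
Valiant's hypothesis*, TCS 235 (2000), Thm. 4.5, p. 82): a system `f_1 = ⋯ = f_s = 0`,
`f_i ∈ ℤ[X_1, …, X_n]` of degree `≤ d` (`n < d`) and weight `≤ w`, solvable over `ℂ`, has a
solution `x_i = λ⁻¹ v_i(y)` with `λ ∈ ℕ_{>0}`, `v_i ∈ ℤ[Y]`, `y` algebraic with primitive integer
minimal polynomial `g`, `deg g, deg v_i ≤ d^{O(n)}` and `log λ, log wt(g), log wt(v_i) ≤
d^{O(n)} log w`. Bürgisser imports the geometric part from Bézout's inequality (Lemmas 4.3–4.4) and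
the arithmetic part from Krick–Pardo's bounds for geometric resolutions ([18, Prop. 27]). The proof
given here is the ELEMENTARY route of this library:

1. `exists_zeroDim_square_system` (`BurgisserZeroDimSlice.lean`): a square integer system `F`
   with finite complex zero set through a solution `z₀` of `(S)`;
2. the perturbed characteristic polynomial (`PerturbedCharpoly.lean`): for every integer linear
   form `u`, `u(z₀)` is a root of `Q_u = sLead (pertCharpoly (d+1) F u k) ∈ ℤ[T] ∖ {0}` of degree
   `≤ (d+1)ⁿ` (`aeval_sLead_pertCharpoly_eq_zero`, transferring the limit lemma from `ℂ` to `ℤ`)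
   and weight `≤ (1 + W^k wt u)^{(d+1)ⁿ}` (`BurgisserPerturbedCharpolyHeight.lean`);
3. a primitive element `y = Σ ℓ_j z₀_j` with `ℓ_j ≤ ((d+1)^{n²})²` (the embeddings of
   `ℚ(z₀)` into `ℂ` are at most `(d+1)^{n²}`, being determined by the images of the `z₀_j`, which
   are roots of the `Q_{X_j}`; a point of the box separating them exists by the Combinatorial
   Nullstellensatz; then `ℚ(y) = ℚ(z₀)` by `Field.primitive_element_iff_algHom_eq_of_eval'`);
4. `g` = the irreducible factor of `Q_u` vanishing at `y` (Gauss, Mignotte), and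
   `exists_lam_v_of_root` (`BurgisserLagrangeHeights.lean`) for each coordinate `z₀_j = r_j(y)`;
5. bookkeeping: every quantity is `≤ (2w)^E` with `E ≤ 78 (d^{4n})^7`, whence the bounds with
   `a = 156`; the cases `w ≤ 1` / `n = 0` reduce to the zero solution (`thm45_of_zero_solution`).

* **`algebraicSolution_height_bound_holds : algebraicSolution_height_bound`**.

## References

* P. Bürgisser, *Cook's versus Valiant's hypothesis*, TCS 235 (2000) 71–88, Thm. 4.5 and its
  proof (p. 80–82). [Burgisser2000TCS]
-/

noncomputable section

open MvPolynomial
open Literature.RingTheory.Elimination Literature.RingTheory.NoetherNormalization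

namespace Literature.Computability.AlgebraicComplexity

/-! ### Transfer of the perturbed characteristic polynomial from `ℤ` to `ℂ` -/

section Transfer

variable {n D : ℕ}

/-- `mapRingHom cast ∘ C = C ∘ cast` on `ℤ → ℂ[s]`. [folklore] -/
theorem mapRingHom_comp_polynomialC :
    (Polynomial.mapRingHom (Int.castRingHom ℂ)).comp Polynomial.C =
      (Polynomial.C : ℂ →+* Polynomial ℂ).comp (Int.castRingHom ℂ) := by
  ext m
  simp

/-- The perturbed tails commute with `ℤ → ℂ`. [folklore] -/
theorem pertTail_map_cast (F : Fin n → MvPolynomial (Fin n) ℤ) (i : Fin n) :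
    MvPolynomial.map (Polynomial.mapRingHom (Int.castRingHom ℂ)) (pertTail F i) =
      pertTail (fun i => MvPolynomial.map (Int.castRingHom ℂ) (F i)) i := by
  unfold pertTail
  rw [map_neg, map_mul, map_C, Polynomial.coe_mapRingHom, Polynomial.map_X, map_map, map_map,
    mapRingHom_comp_polynomialC]

/-- The perturbed rewriting matrix commutes with `ℤ → ℂ`. [folklore] -/
theorem pertMatrix_map_cast (F : Fin n → MvPolynomial (Fin n) ℤ) (u : MvPolynomial (Fin n) ℤ) (k : ℕ) :
    (pertMatrix D F u k).map (Polynomial.mapRingHom (Int.castRingHom ℂ)) =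
      pertMatrix D (fun i => MvPolynomial.map (Int.castRingHom ℂ) (F i))
        (MvPolynomial.map (Int.castRingHom ℂ) u) k := by
  unfold pertMatrix
  rw [rewriteMatrix_map]
  have h1 : (fun i => MvPolynomial.map (Polynomial.mapRingHom (Int.castRingHom ℂ)) (pertTail F i)) =
      pertTail (fun i => MvPolynomial.map (Int.castRingHom ℂ) (F i)) := funext (pertTail_map_cast F)
  have h2 : MvPolynomial.map (Polynomial.mapRingHom (Int.castRingHom ℂ)) (MvPolynomial.map Polynomial.C u) =
      MvPolynomial.map Polynomial.C (MvPolynomial.map (Int.castRingHom ℂ) u) := by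
    rw [map_map, map_map, mapRingHom_comp_polynomialC]
  rw [h1, h2]

/-- The perturbed characteristic polynomial commutes with `ℤ → ℂ`. [folklore] -/
theorem pertCharpoly_map_cast (F : Fin n → MvPolynomial (Fin n) ℤ) (u : MvPolynomial (Fin n) ℤ)
    (k : ℕ) :
    (pertCharpoly D F u k).map (Polynomial.mapRingHom (Int.castRingHom ℂ)) =
      pertCharpoly D (fun i => MvPolynomial.map (Int.castRingHom ℂ) (F i))
        (MvPolynomial.map (Int.castRingHom ℂ) u) k := by
  unfold pertCharpoly
  rw [← Matrix.charpoly_map, pertMatrix_map_cast]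

/-- `sDeg` is invariant under an injective coefficient map. [folklore] -/
theorem sDeg_map_of_injective {R S : Type*} [CommRing R] [CommRing S] (f : R →+* S)
    (hf : Function.Injective f) (P : Polynomial (Polynomial R)) :
    sDeg (P.map (Polynomial.mapRingHom f)) = sDeg P := by
  unfold sDeg
  rw [Polynomial.support_map_of_injective _ (Polynomial.map_injective f hf)]
  refine Finset.sup_congr rfl fun k _ => ?_
  rw [Polynomial.coeff_map, Polynomial.coe_mapRingHom, Polynomial.natDegree_map_eq_of_injective hf]

/-- `sLead` commutes with an injective coefficient map. [folklore] -/
theorem sLead_map_of_injective {R S : Type*} [CommRing R] [CommRing S] (f : R →+* S)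
    (hf : Function.Injective f) (P : Polynomial (Polynomial R)) :
    sLead (P.map (Polynomial.mapRingHom f)) = (sLead P).map f := by
  unfold sLead
  rw [sDeg_map_of_injective f hf, Polynomial.support_map_of_injective _ (Polynomial.map_injective f hf),
    Polynomial.map_sum]
  refine Finset.sum_congr rfl fun k _ => ?_
  rw [Polynomial.map_monomial, Polynomial.coeff_map, Polynomial.coe_mapRingHom, Polynomial.coeff_map]

/-- **The root property over `ℤ`**: for an integer square system `F` of degree `< D` with FINITE
complex zero set, every complex zero `z` of `F` and every integer polynomial `u`, `u(z)` is a root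
of `Q_u = sLead (pertCharpoly D F u k) ∈ ℤ[T]` (`k` large). (The limit lemma of
`PerturbedCharpoly.lean`, transferred along `ℤ → ℂ`.) [cite: Burgisser2000TCS, Thm. 4.5 (proof) p. 82] -/
theorem aeval_sLead_pertCharpoly_eq_zero (hD : 0 < D) (F : Fin n → MvPolynomial (Fin n) ℤ)
    (hF : ∀ i, (F i).totalDegree < D) (hfin : {z : Fin n → ℂ | ∀ i, aeval z (F i) = 0}.Finite)
    {z : Fin n → ℂ} (hz : ∀ i, aeval z (F i) = 0) (u : MvPolynomial (Fin n) ℤ) {k : ℕ}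
    (hk : u.totalDegree + n * (D - 1) + 1 ≤ k) :
    Polynomial.aeval (aeval z u) (sLead (pertCharpoly D F u k)) = 0 := by
  set FC : Fin n → MvPolynomial (Fin n) ℂ := fun i => MvPolynomial.map (Int.castRingHom ℂ) (F i)
    with hFCdef
  set uC : MvPolynomial (Fin n) ℂ := MvPolynomial.map (Int.castRingHom ℂ) u with huC
  have hFC : ∀ i, (FC i).totalDegree < D := fun i => lt_of_le_of_lt (totalDegree_map_int_le _) (hF i)
  have hset : {x : Fin n → ℂ | ∀ i, eval x (FC i) = 0} = {z : Fin n → ℂ | ∀ i, aeval z (F i) = 0} := by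
    ext x; simp only [Set.mem_setOf_eq, hFCdef, aeval_eq_eval_map_int]
  have hfinC : {x : Fin n → ℂ | ∀ i, eval x (FC i) = 0}.Finite := by rw [hset]; exact hfin
  have hzC : ∀ i, eval z (FC i) = 0 := fun i => by rw [hFCdef]; dsimp only; rw [← aeval_eq_eval_map_int]; exact hz i
  have hkC : uC.totalDegree + n * (D - 1) + 1 ≤ k :=
    le_trans (Nat.add_le_add_right (Nat.add_le_add_right (totalDegree_map_int_le u) _) _) hk
  have h := eval_sLead_pertCharpoly_eq_zero hD FC hFC hfinC hzC uC hkC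
  rw [hFCdef, huC, ← pertCharpoly_map_cast, sLead_map_of_injective _ Int.cast_injective,
    Polynomial.eval_map, ← aeval_eq_eval_map_int z u] at h
  rwa [Polynomial.aeval_def, algebraMap_int_eq]

end Transfer

/-! ### The size of `projBound` -/

/-- `projBound m δ ≤ (m + δ + 4)^(5^m)`: the integer coefficients of the linear section are at most
doubly exponential in `m`, so their LOGARITHM is single-exponential. [folklore] -/
theorem projBound_le (m δ : ℕ) : projBound m δ ≤ (m + δ + 4) ^ (5 ^ m) := by
  induction m generalizing δ with
  | zero => rw [projBound, pow_zero, pow_one]; omega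
  | succ m ih =>
    rw [projBound]
    have h5 : 1 ≤ 5 ^ m := Nat.one_le_pow _ _ (by norm_num)
    have h1 : (m + 1) * (δ + 1) ≤ (m + 1 + δ + 4) ^ 2 := by nlinarith
    have h2 : m + 2 * δ * δ + 4 ≤ (m + 1 + δ + 4) ^ 3 := by nlinarith
    calc (m + 1) * (δ + 1) * projBound m (2 * δ * δ)
        ≤ (m + 1) * (δ + 1) * (m + 2 * δ * δ + 4) ^ (5 ^ m) := Nat.mul_le_mul_left _ (ih _)
      _ ≤ (m + 1 + δ + 4) ^ 2 * ((m + 1 + δ + 4) ^ 3) ^ (5 ^ m) :=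
          Nat.mul_le_mul h1 (Nat.pow_le_pow_left h2 _)
      _ = (m + 1 + δ + 4) ^ (2 + 3 * 5 ^ m) := by rw [← pow_mul, ← pow_add]
      _ ≤ (m + 1 + δ + 4) ^ (5 ^ (m + 1)) := Nat.pow_le_pow_right (by omega) (by rw [pow_succ]; omega)

/-! ### A primitive element with small integer coefficients -/

section Primitive

/-- A grid point where a nonzero polynomial does not vanish (Combinatorial Nullstellensatz):
if `0 ≠ P ∈ ℂ[X_1, …, X_n]` has total degree `≤ B` then `P(ℓ) ≠ 0` for some `ℓ ∈ {0, …, B}ⁿ`.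
[folklore] -/
theorem exists_nat_eval_ne_zero {n B : ℕ} {P : MvPolynomial (Fin n) ℂ} (hP : P ≠ 0)
    (hdeg : P.totalDegree ≤ B) : ∃ ℓ : Fin n → ℕ, (∀ j, ℓ j ≤ B) ∧ eval (fun j => (ℓ j : ℂ)) P ≠ 0 := by
  classical
  obtain ⟨t, ht, htdeg⟩ : ∃ t ∈ P.support, (t.sum fun _ e => e) = P.totalDegree := by
    obtain ⟨t, ht, h⟩ := Finset.exists_mem_eq_sup P.support (support_nonempty.2 hP)
      (fun s : Fin n →₀ ℕ => s.sum fun _ e => e)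
    exact ⟨t, ht, h.symm⟩
  have htdeg' : P.totalDegree = t.degree := by
    rw [Finsupp.degree_eq_sum, ← Finsupp.sum_fintype t (fun _ e => e) (fun _ => rfl), htdeg]
  set Sj : Fin n → Finset ℂ := fun _ => (Finset.range (B + 1)).image (Nat.cast : ℕ → ℂ) with hSj
  obtain ⟨sv, hsv, hev⟩ := MvPolynomial.combinatorial_nullstellensatz_exists_eval_nonzero P t
    (mem_support_iff.1 ht) htdeg' Sj (fun i => by
      rw [hSj]
      dsimp only
      rw [Finset.card_image_of_injective _ Nat.cast_injective, Finset.card_range]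
      calc t i ≤ t.degree := by
            rw [Finsupp.degree_eq_sum]
            exact Finset.single_le_sum (f := fun j => t j) (fun _ _ => Nat.zero_le _) (Finset.mem_univ i)
        _ = P.totalDegree := htdeg'.symm
        _ < B + 1 := Nat.lt_succ_of_le hdeg)
  have hl : ∀ j, ∃ l : ℕ, l ≤ B ∧ (l : ℂ) = sv j := fun j => by
    obtain ⟨l, hl, hl'⟩ := Finset.mem_image.1 (hsv j)
    exact ⟨l, Nat.lt_succ_iff.1 (Finset.mem_range.1 hl), hl'⟩
  choose ℓ hℓB hℓ using hl
  refine ⟨ℓ, hℓB, ?_⟩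
  have : (fun j => (ℓ j : ℂ)) = sv := funext hℓ
  rw [this]; exact hev

/-- **A primitive element of `ℚ(z_1, …, z_n)` with small natural coefficients.** Let `z_j ∈ ℂ` be
roots of nonzero `Q_j ∈ ℤ[T]` of degree `≤ N`. Then there are `ℓ_j ∈ ℕ`, `ℓ_j ≤ (Nⁿ)²`, such
that for `y = Σ_j ℓ_j z_j` every `z_j` is a polynomial in `y` over `ℚ` of degree `< deg minpoly y`:
the `ℚ`-embeddings of `ℚ(z)` into `ℂ` are at most `Nⁿ` (they are determined by the images of the
`z_j`, roots of the `Q_j`); a grid point `ℓ` separating them exists by the Combinatorial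
Nullstellensatz, and then `ℚ(y) = ℚ(z)` (`Field.primitive_element_iff_algHom_eq_of_eval'`).
[folklore] -/
theorem exists_primitive_nat_combination {n N : ℕ} (z : Fin n → ℂ) (Q : Fin n → Polynomial ℤ)
    (hQ0 : ∀ j, Q j ≠ 0) (hQ : ∀ j, Polynomial.aeval (z j) (Q j) = 0) (hN : ∀ j, (Q j).natDegree ≤ N) :
    ∃ ℓ : Fin n → ℕ, (∀ j, ℓ j ≤ (N ^ n) ^ 2) ∧ IsIntegral ℚ (∑ j, (ℓ j : ℂ) * z j) ∧
      ∀ j, ∃ r : Polynomial ℚ, r.natDegree < (minpoly ℚ (∑ j, (ℓ j : ℂ) * z j)).natDegree ∧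
        Polynomial.aeval (∑ j, (ℓ j : ℂ) * z j) r = z j := by
  classical
  -- integrality of the `z_j`
  have hzint : ∀ j, IsIntegral ℚ (z j) := fun j => by
    refine (show IsAlgebraic ℚ (z j) from ⟨(Q j).map (Int.castRingHom ℚ), ?_, ?_⟩).isIntegral
    · exact (Polynomial.map_ne_zero_iff (Int.castRingHom ℚ).injective_int).2 (hQ0 j)
    · rw [← algebraMap_int_eq, Polynomial.aeval_map_algebraMap]; exact hQ j
  -- the field `K₀ = ℚ(z)`
  set K₀ : IntermediateField ℚ ℂ := IntermediateField.adjoin ℚ (Set.range z) with hK₀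
  have hint : ∀ x ∈ Set.range z, IsIntegral ℚ x := by rintro _ ⟨j, rfl⟩; exact hzint j
  haveI : FiniteDimensional ℚ K₀ := IntermediateField.finiteDimensional_adjoin hint
  set gen : Fin n → K₀ := fun j => ⟨z j, IntermediateField.subset_adjoin _ _ ⟨j, rfl⟩⟩ with hgen
  have hgenval : ∀ j, (gen j : ℂ) = z j := fun j => rfl
  -- embeddings are determined by the images of the generators
  have hext : ∀ φ ψ : K₀ →ₐ[ℚ] ℂ, (∀ j, φ (gen j) = ψ (gen j)) → φ = ψ := by
    intro φ ψ h
    refine IntermediateField.adjoin_algHom_ext ℚ fun x hx => ?_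
    obtain ⟨j, rfl⟩ := hx
    exact h j
  -- the images of the generators are roots of the `Q_j`
  have hroot : ∀ (φ : K₀ →ₐ[ℚ] ℂ) j, Polynomial.aeval (φ (gen j)) (Q j) = 0 := by
    intro φ j
    set QQ : Polynomial ℚ := (Q j).map (algebraMap ℤ ℚ) with hQQ
    have hQQ' : ∀ {B : Type} [CommRing B] [Algebra ℚ B] (x : B),
        Polynomial.aeval x QQ = Polynomial.aeval x (Q j) := fun x => by
      rw [hQQ, Polynomial.aeval_map_algebraMap]
    have h1 : Polynomial.aeval (gen j) QQ = 0 := by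
      have h2 : (K₀.val) (Polynomial.aeval (gen j) QQ) = 0 := by
        rw [← Polynomial.aeval_algHom_apply, hQQ']; exact hQ j
      exact (map_eq_zero_iff _ (RingHom.injective _)).1 h2
    rw [← hQQ', Polynomial.aeval_algHom_apply, h1, map_zero]
  -- hence at most `N^n` embeddings
  set Rt : Fin n → Finset ℂ := fun j => ((Q j).map (Int.castRingHom ℂ)).roots.toFinset with hRt
  have hcardR : ∀ j, (Rt j).card ≤ N := fun j => by
    rw [hRt]
    refine (Multiset.toFinset_card_le _).trans ((Polynomial.card_roots' _).trans ?_)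
    rw [Polynomial.natDegree_map_eq_of_injective (Int.castRingHom ℂ).injective_int]
    exact hN j
  have hcardEmb : Fintype.card (K₀ →ₐ[ℚ] ℂ) ≤ N ^ n := by
    have h1 : (Finset.univ : Finset (K₀ →ₐ[ℚ] ℂ)).card ≤ (Fintype.piFinset Rt).card := by
      refine Finset.card_le_card_of_injOn (fun φ => fun j => φ (gen j)) (fun φ _ => ?_) ?_
      · rw [Finset.mem_coe, Fintype.mem_piFinset]
        intro j
        rw [hRt]
        dsimp only
        rw [Multiset.mem_toFinset, Polynomial.mem_roots ((Polynomial.map_ne_zero_iff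
          (Int.castRingHom ℂ).injective_int).2 (hQ0 j)), Polynomial.IsRoot.def, Polynomial.eval_map,
          ← algebraMap_int_eq, ← Polynomial.aeval_def]
        exact hroot φ j
      · intro φ _ ψ _ h
        exact hext φ ψ fun j => congrFun h j
    calc Fintype.card (K₀ →ₐ[ℚ] ℂ) = (Finset.univ : Finset (K₀ →ₐ[ℚ] ℂ)).card := Finset.card_univ.symm
      _ ≤ (Fintype.piFinset Rt).card := h1
      _ = ∏ j, (Rt j).card := Fintype.card_piFinset Rt
      _ ≤ ∏ _j : Fin n, N := Finset.prod_le_prod' fun j _ => hcardR j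
      _ = N ^ n := by rw [Finset.prod_const, Finset.card_univ, Fintype.card_fin]
  -- a grid point separating the embeddings
  set prs := ((Finset.univ : Finset (K₀ →ₐ[ℚ] ℂ)) ×ˢ (Finset.univ : Finset (K₀ →ₐ[ℚ] ℂ))).filter
    (fun pp => pp.1 ≠ pp.2) with hprs
  set P : MvPolynomial (Fin n) ℂ := ∏ pp ∈ prs, ∑ j, C (pp.1 (gen j) - pp.2 (gen j)) * X j with hPdef
  have hP0 : P ≠ 0 := by
    rw [hPdef, Finset.prod_ne_zero_iff]
    intro pp hpp
    have hne : pp.1 ≠ pp.2 := (Finset.mem_filter.1 hpp).2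
    have : ∃ j, pp.1 (gen j) - pp.2 (gen j) ≠ 0 := by
      by_contra h
      push Not at h
      exact hne (hext _ _ fun j => sub_eq_zero.1 (h j))
    obtain ⟨j, hj⟩ := this
    exact sum_C_mul_X_ne_zero hj
  have hPdeg : P.totalDegree ≤ (N ^ n) ^ 2 := by
    rw [hPdef]
    refine (totalDegree_finsetProd _ _).trans ?_
    calc ∑ pp ∈ prs, (∑ j, C (pp.1 (gen j) - pp.2 (gen j)) * X j : MvPolynomial (Fin n) ℂ).totalDegree
        ≤ ∑ _pp ∈ prs, 1 := Finset.sum_le_sum fun pp _ => totalDegree_finsetSum_le fun j _ =>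
            (totalDegree_mul _ _).trans (by rw [totalDegree_C, totalDegree_X, zero_add])
      _ = prs.card := by rw [Finset.sum_const, smul_eq_mul, mul_one]
      _ ≤ (Finset.univ ×ˢ (Finset.univ : Finset (K₀ →ₐ[ℚ] ℂ))).card := Finset.card_filter_le _ _
      _ = Fintype.card (K₀ →ₐ[ℚ] ℂ) * Fintype.card (K₀ →ₐ[ℚ] ℂ) := by
          rw [Finset.card_product, Finset.card_univ]
      _ ≤ N ^ n * N ^ n := Nat.mul_le_mul hcardEmb hcardEmb
      _ = (N ^ n) ^ 2 := (sq _).symm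
  obtain ⟨ℓ, hℓB, hℓev⟩ := exists_nat_eval_ne_zero hP0 hPdeg
  have hsep : ∀ φ ψ : K₀ →ₐ[ℚ] ℂ, φ ≠ ψ → ∑ j, (φ (gen j) - ψ (gen j)) * (ℓ j : ℂ) ≠ 0 := by
    intro φ ψ hne h0
    apply hℓev
    rw [hPdef, map_prod]
    refine Finset.prod_eq_zero (i := (φ, ψ)) (Finset.mem_filter.2 ⟨Finset.mem_product.2
      ⟨Finset.mem_univ φ, Finset.mem_univ ψ⟩, hne⟩) ?_
    rw [map_sum]
    simp only [map_mul, eval_C, eval_X]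
    exact h0
  -- the element `y` and its avatar `yK ∈ K₀`
  set y : ℂ := ∑ j, (ℓ j : ℂ) * z j with hy
  set yK : K₀ := ∑ j, (ℓ j : ℚ) • gen j with hyK
  have hyKval : (yK : ℂ) = y := by
    rw [hyK, hy, IntermediateField.coe_sum]
    refine Finset.sum_congr rfl fun j _ => ?_
    rw [IntermediateField.coe_smul, hgenval, Rat.smul_def, Rat.cast_natCast]
  have hφy : ∀ φ : K₀ →ₐ[ℚ] ℂ, φ yK = ∑ j, (ℓ j : ℂ) * φ (gen j) := fun φ => by
    rw [hyK, map_sum]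
    refine Finset.sum_congr rfl fun j _ => ?_
    rw [Algebra.smul_def, map_mul, AlgHom.commutes, map_natCast]
  -- `y` is a primitive element of `K₀`
  have hA : ∀ x : K₀, ((minpoly ℚ x).map (algebraMap ℚ ℂ)).Splits := fun x => IsAlgClosed.splits _
  have hprim : IntermediateField.adjoin ℚ {yK} = ⊤ := by
    rw [Field.primitive_element_iff_algHom_eq_of_eval' ℚ ℂ hA yK]
    intro φ ψ h
    by_contra hne
    apply hsep φ ψ hne
    have h' : ∑ j, (ℓ j : ℂ) * φ (gen j) = ∑ j, (ℓ j : ℂ) * ψ (gen j) := by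
      rw [← hφy, ← hφy]; exact h
    rw [← sub_eq_zero, ← Finset.sum_sub_distrib] at h'
    rw [← h']
    exact Finset.sum_congr rfl fun j _ => by ring
  -- integrality of `y`
  have hyint : IsIntegral ℚ y := by
    rw [hy]
    refine IsIntegral.sum _ fun j _ => IsIntegral.mul ?_ (hzint j)
    have : ((ℓ j : ℕ) : ℂ) = algebraMap ℚ ℂ (ℓ j) := by simp
    rw [this]; exact isIntegral_algebraMap
  have hyKint : IsIntegral ℚ yK := IsIntegral.of_finite ℚ yK
  refine ⟨ℓ, hℓB, hyint, fun j => ?_⟩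
  -- `gen j ∈ ℚ⟮yK⟯ = ℚ[yK]`
  have hmem : gen j ∈ (IntermediateField.adjoin ℚ {yK}).toSubalgebra := by
    rw [hprim]; trivial
  rw [IntermediateField.adjoin_simple_toSubalgebra_of_isAlgebraic hyKint.isAlgebraic,
    Algebra.adjoin_singleton_eq_range_aeval] at hmem
  obtain ⟨p, hp⟩ := hmem
  have hpy : Polynomial.aeval y p = z j := by
    rw [← hyKval, ← hgenval j, ← hp]
    change _ = K₀.val (Polynomial.aeval yK p)
    rw [← Polynomial.aeval_algHom_apply]
    rfl
  refine ⟨p %ₘ minpoly ℚ y, Polynomial.natDegree_modByMonic_lt p (minpoly.monic hyint) (minpoly.ne_one ℚ y), ?_⟩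
  rw [Polynomial.aeval_modByMonic_eq_self_of_root (minpoly.aeval ℚ y), hpy]

end Primitive

/-! ### Numerical bookkeeping -/

section Numerics

/-- Elementary size facts for `n < d`, `0 < n`, in terms of `Ω = d^{4n}`. [folklore] -/
theorem basic_bounds {n d : ℕ} (hnd : n < d) (hn : 0 < n) :
    (d + 1) ^ n ≤ d ^ (4 * n) ∧ 5 ^ n ≤ d ^ (4 * n) ∧ n + d + 4 ≤ d ^ (4 * n) ∧ n ≤ d ^ (4 * n) ∧
      d + 2 ≤ d ^ (4 * n) ∧ n * d + 2 ≤ d ^ (4 * n) ∧ 2 ≤ d ^ (4 * n) := by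
  have hd2 : 2 ≤ d := by omega
  have hd1 : 1 ≤ d := by omega
  have hd3 : 8 ≤ d ^ 3 := by
    calc 8 = 2 ^ 3 := by norm_num
      _ ≤ d ^ 3 := Nat.pow_le_pow_left hd2 3
  have h3Ω : d ^ 3 ≤ d ^ (4 * n) := Nat.pow_le_pow_right hd1 (by omega)
  have h1Ω : d ≤ d ^ (4 * n) := by
    calc d = d ^ 1 := (pow_one d).symm
      _ ≤ d ^ (4 * n) := Nat.pow_le_pow_right hd1 (by omega)
  have h4d : 4 * d ≤ d ^ 3 := by
    calc 4 * d = 2 * 2 * d := by ring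
      _ ≤ d * d * d := Nat.mul_le_mul (Nat.mul_le_mul hd2 hd2) le_rfl
      _ = d ^ 3 := by ring
  have hdd : d * d ≤ d ^ 3 := by
    calc d * d = d * d * 1 := (mul_one _).symm
      _ ≤ d * d * d := Nat.mul_le_mul_left _ hd1
      _ = d ^ 3 := by ring
  have hnd' : n * d + d ≤ d * d := by
    have := Nat.mul_le_mul_right d (hnd : n + 1 ≤ d)
    rwa [Nat.succ_mul] at this
  refine ⟨?_, ?_, ?_, ?_, ?_, ?_, ?_⟩
  · calc (d + 1) ^ n ≤ (d ^ 2) ^ n := Nat.pow_le_pow_left (by nlinarith) n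
      _ = d ^ (2 * n) := by rw [← pow_mul]
      _ ≤ d ^ (4 * n) := Nat.pow_le_pow_right hd1 (by omega)
  · calc 5 ^ n ≤ (d ^ 3) ^ n := Nat.pow_le_pow_left (by omega) n
      _ = d ^ (3 * n) := by rw [← pow_mul]
      _ ≤ d ^ (4 * n) := Nat.pow_le_pow_right hd1 (by omega)
  · have : n + d + 4 ≤ d ^ 3 := by omega
    exact this.trans h3Ω
  · exact (le_of_lt hnd).trans h1Ω
  · have : d + 2 ≤ d ^ 3 := by omega
    exact this.trans h3Ω
  · have : n * d + 2 ≤ d ^ 3 := by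
      have : n * d + 2 ≤ d * d := by omega
      exact this.trans hdd
    exact this.trans h3Ω
  · exact hd2.trans h1Ω

/-- **The exponent bookkeeping**: with `N = (d+1)ⁿ`, `k₀ = n d + 2`,
`E_F = n(d+2) + n + (n+d+4)5ⁿ + 1`, `E_u = n + 2 n N + 1`, the final exponent
`n (1 + N + N (E_F k₀ + E_u + 2)) (3 N² + 3)` is at most `66 (d^{4n})^7`. [folklore] -/
theorem exponent_bound {n d : ℕ} (hnd : n < d) (hn : 0 < n) :
    n * ((1 + (d + 1) ^ n + (d + 1) ^ n * ((n * (d + 2) + n + (n + d + 4) * 5 ^ n + 1) * (n * d + 2) +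
      (n + 2 * n * (d + 1) ^ n + 1) + 2)) * (3 * ((d + 1) ^ n) ^ 2 + 3)) ≤ 66 * (d ^ (4 * n)) ^ 7 := by
  obtain ⟨hN, h5, hnd4, hnΩ, hd2Ω, hk0, h2Ω⟩ := basic_bounds hnd hn
  set Ω := d ^ (4 * n) with hΩ
  set N := (d + 1) ^ n with hNdef
  have h1Ω : 1 ≤ Ω := le_trans (by norm_num) h2Ω
  have hΩ2 : Ω ≤ Ω ^ 2 := by nlinarith
  have hΩ23 : Ω ^ 2 ≤ Ω ^ 3 := by nlinarith
  have hEF : n * (d + 2) + n + (n + d + 4) * 5 ^ n + 1 ≤ 4 * Ω ^ 2 := by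
    have : n * (d + 2) + n + (n + d + 4) * 5 ^ n + 1 ≤ Ω * Ω + Ω + Ω * Ω + Ω :=
      Nat.add_le_add (Nat.add_le_add (Nat.add_le_add (Nat.mul_le_mul hnΩ hd2Ω) hnΩ)
        (Nat.mul_le_mul hnd4 h5)) h1Ω
    nlinarith
  have hEu : n + 2 * n * N + 1 ≤ 4 * Ω ^ 2 := by
    have : n + 2 * n * N + 1 ≤ Ω + 2 * Ω * Ω + Ω :=
      Nat.add_le_add (Nat.add_le_add hnΩ (Nat.mul_le_mul (Nat.mul_le_mul_left 2 hnΩ) hN)) h1Ω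
    nlinarith
  have hinner : (n * (d + 2) + n + (n + d + 4) * 5 ^ n + 1) * (n * d + 2) +
      (n + 2 * n * N + 1) + 2 ≤ 9 * Ω ^ 3 := by
    have : (n * (d + 2) + n + (n + d + 4) * 5 ^ n + 1) * (n * d + 2) + (n + 2 * n * N + 1) + 2 ≤
        4 * Ω ^ 2 * Ω + 4 * Ω ^ 2 + Ω := Nat.add_le_add (Nat.add_le_add (Nat.mul_le_mul hEF hk0) hEu) h2Ω
    nlinarith
  have hEH : N * ((n * (d + 2) + n + (n + d + 4) * 5 ^ n + 1) * (n * d + 2) +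
      (n + 2 * n * N + 1) + 2) ≤ 9 * Ω ^ 4 := by
    have := Nat.mul_le_mul hN hinner
    nlinarith
  have hs1 : 1 + N + N * ((n * (d + 2) + n + (n + d + 4) * 5 ^ n + 1) * (n * d + 2) +
      (n + 2 * n * N + 1) + 2) ≤ 11 * Ω ^ 4 := by
    have hΩ4 : Ω ≤ Ω ^ 4 := by nlinarith
    nlinarith
  have hs2 : 3 * N ^ 2 + 3 ≤ 6 * Ω ^ 2 := by
    have : N ^ 2 ≤ Ω ^ 2 := Nat.pow_le_pow_left hN 2
    nlinarith
  calc n * ((1 + N + N * ((n * (d + 2) + n + (n + d + 4) * 5 ^ n + 1) * (n * d + 2) +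
        (n + 2 * n * N + 1) + 2)) * (3 * N ^ 2 + 3))
      ≤ Ω * ((11 * Ω ^ 4) * (6 * Ω ^ 2)) := Nat.mul_le_mul hnΩ (Nat.mul_le_mul hs1 hs2)
    _ = 66 * Ω ^ 7 := by ring

/-- `log X ≤ 2 E log w` when `X ≤ (2w)^E` and `w ≥ 2`. [folklore] -/
theorem log_le_of_le_pow {X E w : ℕ} (hX : X ≤ (2 * w) ^ E) (hw : 2 ≤ w) :
    Real.log X ≤ 2 * E * Real.log w := by
  have hw0 : (0 : ℝ) < w := by exact_mod_cast (lt_of_lt_of_le Nat.zero_lt_two hw)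
  have hlogw : 0 ≤ Real.log w := Real.log_nonneg (by exact_mod_cast le_trans one_le_two hw)
  have hlog2 : Real.log 2 ≤ Real.log w := Real.log_le_log two_pos (by exact_mod_cast hw)
  rcases Nat.eq_zero_or_pos X with rfl | hXpos
  · rw [Nat.cast_zero, Real.log_zero]; positivity
  calc Real.log X ≤ Real.log ((2 * w : ℕ) ^ E : ℕ) :=
        Real.log_le_log (by exact_mod_cast hXpos) (by exact_mod_cast hX)
    _ = E * (Real.log 2 + Real.log w) := by
        push_cast
        rw [Real.log_pow, Real.log_mul two_ne_zero hw0.ne']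
    _ ≤ E * (Real.log w + Real.log w) := by gcongr
    _ = 2 * E * Real.log w := by ring

end Numerics

/-! ### The main construction -/

section Core

/-- Powers of `2` are below powers of `2w`. [folklore] -/
theorem two_pow_le_pow {w a : ℕ} (hw : 2 ≤ w) : 2 ^ a ≤ (2 * w) ^ a :=
  Nat.pow_le_pow_left (by omega) a

set_option maxHeartbeats 2000000 in
/-- **Bürgisser's Theorem 4.5, main case** (`n ≥ 1`, `w ≥ 2`), with all bounds as natural-number
inequalities `≤ (2w)^(66 (d^{4n})^7)` resp. `≤ d^{2n}`. See the module docstring for the proof.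
[cite: Burgisser2000TCS, Thm. 4.5 p. 82] -/
theorem thm45_core {n s d w : ℕ} (S : Fin s → MvPolynomial (Fin n) ℤ) (hnd : n < d) (hn : 0 < n)
    (hw : 2 ≤ w) (hdeg : ∀ i, (S i).totalDegree ≤ d) (hwt : ∀ i, weight (S i) ≤ w)
    (hsol : ∃ z : Fin n → ℂ, ∀ i, aeval z (S i) = 0) :
    ∃ (lam : ℕ) (v : Fin n → Polynomial ℤ) (g : Polynomial ℤ) (y : ℂ),
      0 < lam ∧ Irreducible g ∧ g.IsPrimitive ∧ 0 < g.natDegree ∧ Polynomial.aeval y g = 0 ∧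
      (∀ i, aeval (fun j => (lam : ℂ)⁻¹ * Polynomial.aeval y (v j)) (S i) = 0) ∧
      g.natDegree ≤ d ^ (4 * n) ∧ (∀ j, (v j).natDegree ≤ d ^ (4 * n)) ∧
      lam ≤ (2 * w) ^ (66 * (d ^ (4 * n)) ^ 7) ∧ polyWeight g ≤ (2 * w) ^ (66 * (d ^ (4 * n)) ^ 7) ∧
      ∀ j, polyWeight (v j) ≤ (2 * w) ^ (66 * (d ^ (4 * n)) ^ 7) := by
  classical
  obtain ⟨hNΩ, h5Ω, hnd4Ω, hnΩ, hd2Ω, hk0Ω, h2Ω⟩ := basic_bounds hnd hn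
  have hd2 : 2 ≤ d := by omega
  -- Step 1: the zero-dimensional square system
  obtain ⟨F, hFdeg, hFwt, hFfin, z₀, hFz₀, hSz₀⟩ := exists_zeroDim_square_system S hdeg hwt hsol
  have hmaxd : max d 1 = d := max_eq_left (by omega)
  set WF : ℕ := max ((d + 2) ^ n * w) (n * projBound n d) with hWF
  have hWF1 : 1 ≤ WF := le_trans (Nat.one_le_iff_ne_zero.2 (Nat.mul_ne_zero
    (pow_ne_zero _ (by omega)) (by omega))) (le_max_left _ _)
  -- Step 2: the perturbed characteristic polynomials
  set D : ℕ := d + 1 with hDdef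
  set N : ℕ := D ^ n with hNdef
  set k₀ : ℕ := n * d + 2 with hk₀
  have hD : 0 < D := by omega
  have hN1 : 1 ≤ N := Nat.one_le_pow _ _ hD
  have hFD : ∀ i, (F i).totalDegree < D := fun i => by
    have := hFdeg i; rw [hmaxd] at this; omega
  have hk : ∀ u : MvPolynomial (Fin n) ℤ, u.totalDegree ≤ 1 → u.totalDegree + n * (D - 1) + 1 ≤ k₀ := by
    intro u hu; rw [hk₀, hDdef, Nat.add_sub_cancel]; omega
  -- facts about `Q_u`
  have hQ0 : ∀ u : MvPolynomial (Fin n) ℤ, sLead (pertCharpoly D F u k₀) ≠ 0 := fun u =>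
    sLead_ne_zero (pertCharpoly_ne_zero _ _ _ _)
  have hQdeg : ∀ u : MvPolynomial (Fin n) ℤ, (sLead (pertCharpoly D F u k₀)).natDegree ≤ N := fun u =>
    natDegree_sLead_pertCharpoly_le _ _ _ _
  have hQwt : ∀ u : MvPolynomial (Fin n) ℤ,
      polyWeight (sLead (pertCharpoly D F u k₀)) ≤ (1 + WF ^ k₀ * weight u) ^ N := fun u =>
    polyWeight_sLead_pertCharpoly_le F hWF1 hFwt u k₀
  have hQroot : ∀ u : MvPolynomial (Fin n) ℤ, u.totalDegree ≤ 1 →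
      Polynomial.aeval (aeval z₀ u) (sLead (pertCharpoly D F u k₀)) = 0 := fun u hu =>
    aeval_sLead_pertCharpoly_eq_zero hD F hFD hFfin hFz₀ u (hk u hu)
  -- Step 3: coordinates and the primitive element
  set Qj : Fin n → Polynomial ℤ := fun j => sLead (pertCharpoly D F (X j) k₀) with hQj
  have hXdeg : ∀ j : Fin n, (X j : MvPolynomial (Fin n) ℤ).totalDegree ≤ 1 := fun j => by
    rw [totalDegree_X]
  have hQjroot : ∀ j, Polynomial.aeval (z₀ j) (Qj j) = 0 := fun j => by
    have := hQroot (X j) (hXdeg j); rwa [aeval_X] at this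
  obtain ⟨ℓ, hℓB, hyint, hrep⟩ := exists_primitive_nat_combination z₀ Qj (fun j => hQ0 _) hQjroot
    (fun j => hQdeg _)
  set B : ℕ := (N ^ n) ^ 2 with hB
  set y : ℂ := ∑ j, (ℓ j : ℂ) * z₀ j with hy
  set u : MvPolynomial (Fin n) ℤ := ∑ j, C ((ℓ j : ℕ) : ℤ) * X j with hu
  have huy : aeval z₀ u = y := by
    rw [hu, aeval_linearForm, hy]
    refine Finset.sum_congr rfl fun j _ => ?_
    rw [Int.cast_natCast]
  have hudeg : u.totalDegree ≤ 1 := by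
    rw [hu]
    refine totalDegree_finsetSum_le fun j _ => (totalDegree_mul _ _).trans ?_
    rw [totalDegree_C, totalDegree_X]
  have huwt : weight u ≤ n * B := by
    rw [hu]; exact weight_linearForm_le _ fun j => by rw [Nat.abs_cast]; exact_mod_cast hℓB j
  set Qu : Polynomial ℤ := sLead (pertCharpoly D F u k₀) with hQu
  have hQuy : Polynomial.aeval y Qu = 0 := by rw [← huy]; exact hQroot u hudeg
  -- Step 4: the minimal polynomial `g`
  obtain ⟨g, hgirr, hgdvd, hgy⟩ := exists_irreducible_factor_of_aeval_eq_zero (hQ0 u) hQuy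
  obtain ⟨hgpos, hgprim⟩ := natDegree_pos_and_isPrimitive_of_irreducible_of_aeval_eq_zero hgirr hgy
  have hgdeg : g.natDegree ≤ N := (Polynomial.natDegree_le_of_dvd hgdvd (hQ0 u)).trans (hQdeg u)
  have hgmin : (minpoly ℚ y).natDegree = g.natDegree := by
    set gQ : Polynomial ℚ := g.map (Int.castRingHom ℚ) with hgQ
    have hgQirr : Irreducible gQ :=
      (hgprim.irreducible_iff_irreducible_map_fraction_map (K := ℚ)).1 hgirr
    have hgQy : Polynomial.aeval y gQ = 0 := by
      rw [hgQ, ← algebraMap_int_eq, Polynomial.aeval_map_algebraMap]; exact hgy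
    have h1 : minpoly ℚ y ∣ gQ := minpoly.dvd ℚ y hgQy
    have h2 : gQ ∣ minpoly ℚ y := (minpoly.irreducible hyint).dvd_symm hgQirr h1
    have hdegQ : gQ.natDegree = g.natDegree :=
      Polynomial.natDegree_map_eq_of_injective (Int.castRingHom ℚ).injective_int g
    rw [← hdegQ]
    exact le_antisymm (Polynomial.natDegree_le_of_dvd h1 hgQirr.ne_zero)
      (Polynomial.natDegree_le_of_dvd h2 (minpoly.ne_zero hyint))
  -- the common height parameter
  set Hbig : ℕ := 2 ^ N * (1 + WF ^ k₀ * (n * B + 1)) ^ N with hHbig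
  have hHQj : ∀ j, polyWeight (Qj j) ≤ Hbig := fun j => by
    refine (hQwt (X j)).trans ?_
    rw [weight_X, mul_one, hHbig]
    calc (1 + WF ^ k₀) ^ N ≤ (1 + WF ^ k₀ * (n * B + 1)) ^ N :=
          Nat.pow_le_pow_left (Nat.add_le_add_left (Nat.le_mul_of_pos_right _ (by omega)) _) _
      _ ≤ 2 ^ N * (1 + WF ^ k₀ * (n * B + 1)) ^ N := Nat.le_mul_of_pos_left _ (by positivity)
  have hHg : polyWeight g ≤ Hbig := by
    have hmig := polyWeight_le_two_pow_mul_of_dvd (hQ0 u) hgdvd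
    have hnat : polyWeight g ≤ 2 ^ Qu.natDegree * polyWeight Qu := by exact_mod_cast hmig
    refine hnat.trans ?_
    rw [hHbig]
    refine Nat.mul_le_mul (Nat.pow_le_pow_right (by norm_num) (hQdeg u)) ((hQwt u).trans ?_)
    exact Nat.pow_le_pow_left (Nat.add_le_add_left (Nat.mul_le_mul_left _ (huwt.trans (Nat.le_succ _))) _) _
  -- Step 5: `x_j = λ_j⁻¹ v_j(y)`
  have hLH : ∀ j, ∃ (lam : ℕ) (v : Polynomial ℤ), 0 < lam ∧ v.natDegree < g.natDegree ∧
      z₀ j = (lam : ℂ)⁻¹ * Polynomial.aeval y v ∧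
      lam ≤ (2 * g.natDegree * Hbig) ^ (3 * g.natDegree ^ 2 + 3) ∧
      polyWeight v ≤ (2 * g.natDegree * Hbig) ^ (3 * g.natDegree ^ 2 + 3) := by
    intro j
    obtain ⟨r, hrdeg, hry⟩ := hrep j
    have hx : Polynomial.aeval (Polynomial.aeval y (r.map (algebraMap ℚ ℂ))) (Qj j) = 0 := by
      rw [Polynomial.aeval_map_algebraMap, hry]; exact hQjroot j
    obtain ⟨lam, v, hlam, hvdeg, hxv, hlamle, hvle⟩ :=
      exists_lam_v_of_root hgirr hgprim hgpos hgy r (by rw [← hgmin]; exact hrdeg) (hQ0 _) hx hHg (hHQj j)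
    refine ⟨lam, v, hlam, hvdeg, ?_, hlamle, hvle⟩
    rw [← hxv, Polynomial.aeval_map_algebraMap, hry]
  choose lam v hlam hvdeg hxv hlamle hvle using hLH
  -- Step 6: a common denominator
  set Λ : ℕ := ∏ j, lam j with hΛ
  set V : Fin n → Polynomial ℤ := fun j => Polynomial.C ((∏ j' ∈ Finset.univ.erase j, lam j' : ℕ) : ℤ) * v j
    with hV
  have hΛpos : 0 < Λ := Finset.prod_pos fun j _ => hlam j
  have hsolV : ∀ j, (Λ : ℂ)⁻¹ * Polynomial.aeval y (V j) = z₀ j := by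
    intro j
    have hPj : ((∏ j' ∈ Finset.univ.erase j, lam j' : ℕ) : ℂ) ≠ 0 := by
      exact_mod_cast (Finset.prod_pos fun j' _ => hlam j').ne'
    have hΛeq : (Λ : ℂ) = (lam j : ℂ) * ((∏ j' ∈ Finset.univ.erase j, lam j' : ℕ) : ℂ) := by
      rw [hΛ, ← Finset.mul_prod_erase _ _ (Finset.mem_univ j)]; push_cast; rfl
    rw [hV]
    dsimp only
    rw [map_mul, Polynomial.aeval_C, algebraMap_int_eq, eq_intCast, Int.cast_natCast, hΛeq, hxv j,
      mul_inv, mul_assoc, ← mul_assoc (( (∏ j' ∈ Finset.univ.erase j, lam j' : ℕ) : ℂ))⁻¹,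
      inv_mul_cancel₀ hPj, one_mul]
  -- Step 7: the bounds
  set L : ℕ := (2 * N * Hbig) ^ (3 * N ^ 2 + 3) with hL
  have hHbig1 : 1 ≤ Hbig := by rw [hHbig]; exact Nat.one_le_iff_ne_zero.2 (by positivity)
  have h2NH : 1 ≤ 2 * N * Hbig := by
    calc 1 = 1 * 1 * 1 := by norm_num
      _ ≤ 2 * N * Hbig := Nat.mul_le_mul (Nat.mul_le_mul one_le_two hN1) hHbig1
  have hexpg : 3 * g.natDegree ^ 2 + 3 ≤ 3 * N ^ 2 + 3 :=
    Nat.add_le_add_right (Nat.mul_le_mul_left 3 (Nat.pow_le_pow_left hgdeg 2)) 3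
  have hbaseg : 2 * g.natDegree * Hbig ≤ 2 * N * Hbig :=
    Nat.mul_le_mul_right _ (Nat.mul_le_mul_left 2 hgdeg)
  have hmonoL : (2 * g.natDegree * Hbig) ^ (3 * g.natDegree ^ 2 + 3) ≤ L := by
    rw [hL]
    exact (Nat.pow_le_pow_left hbaseg _).trans (Nat.pow_le_pow_right h2NH hexpg)
  have hlamL : ∀ j, lam j ≤ L := fun j => (hlamle j).trans hmonoL
  have hvL : ∀ j, polyWeight (v j) ≤ L := fun j => (hvle j).trans hmonoL
  have hL1' : 1 ≤ L := le_trans (hlam ⟨0, hn⟩) (hlamL _)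
  have hΛL : Λ ≤ L ^ n := by
    rw [hΛ]
    calc ∏ j, lam j ≤ ∏ _j : Fin n, L := Finset.prod_le_prod' fun j _ => hlamL j
      _ = L ^ n := by rw [Finset.prod_const, Finset.card_univ, Fintype.card_fin]
  have hVL : ∀ j, polyWeight (V j) ≤ L ^ n := by
    intro j
    rw [hV]
    dsimp only
    rw [polyWeight_C_mul, Int.natAbs_natCast]
    calc (∏ j' ∈ Finset.univ.erase j, lam j') * polyWeight (v j)
        ≤ (∏ _j' ∈ Finset.univ.erase j, L) * L :=
          Nat.mul_le_mul (Finset.prod_le_prod' fun j' _ => hlamL j') (hvL j)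
      _ = L ^ n := by
          rw [Finset.prod_const, Finset.card_erase_of_mem (Finset.mem_univ j), Finset.card_univ,
            Fintype.card_fin, ← pow_succ, Nat.sub_add_cancel hn]
  -- everything is `≤ (2w)^E`
  set T : ℕ := 2 * w with hT
  have hT1 : 1 ≤ T := by omega
  have hwT : w ≤ T := by omega
  set EF : ℕ := n * (d + 2) + n + (n + d + 4) * 5 ^ n + 1 with hEF
  set Eu : ℕ := n + 2 * n * N + 1 with hEu
  have hWFT : WF ≤ T ^ EF := by
    rw [hWF]
    refine max_le ?_ ?_
    · calc (d + 2) ^ n * w ≤ (2 ^ (d + 2)) ^ n * T :=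
            Nat.mul_le_mul (Nat.pow_le_pow_left ((Nat.lt_two_pow_self).le) _) hwT
        _ = 2 ^ (n * (d + 2)) * T := by rw [← pow_mul, mul_comm (d + 2)]
        _ ≤ T ^ (n * (d + 2)) * T ^ 1 := by rw [pow_one]; exact Nat.mul_le_mul_right _ (two_pow_le_pow hw)
        _ = T ^ (n * (d + 2) + 1) := by rw [← pow_add]
        _ ≤ T ^ EF := Nat.pow_le_pow_right hT1 (by rw [hEF]; omega)
    · calc n * projBound n d ≤ 2 ^ n * (2 ^ (n + d + 4)) ^ (5 ^ n) :=
            Nat.mul_le_mul ((Nat.lt_two_pow_self).le) ((projBound_le n d).trans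
              (Nat.pow_le_pow_left ((Nat.lt_two_pow_self).le) _))
        _ = 2 ^ (n + (n + d + 4) * 5 ^ n) := by rw [← pow_mul, ← pow_add]
        _ ≤ T ^ (n + (n + d + 4) * 5 ^ n) := two_pow_le_pow hw
        _ ≤ T ^ EF := Nat.pow_le_pow_right hT1 (by rw [hEF]; omega)
  have hnB : n * B + 1 ≤ T ^ Eu := by
    have hB2 : B ≤ 2 ^ (2 * n * N) := by
      rw [hB]
      calc (N ^ n) ^ 2 = N ^ (2 * n) := by rw [← pow_mul, mul_comm]
        _ ≤ (2 ^ N) ^ (2 * n) := Nat.pow_le_pow_left ((Nat.lt_two_pow_self).le) _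
        _ = 2 ^ (2 * n * N) := by rw [← pow_mul, mul_comm N]
    calc n * B + 1 ≤ 2 ^ n * 2 ^ (2 * n * N) + 2 ^ n * 2 ^ (2 * n * N) :=
          Nat.add_le_add (Nat.mul_le_mul ((Nat.lt_two_pow_self).le) hB2)
            (Nat.one_le_iff_ne_zero.2 (by positivity))
      _ = 2 ^ (n + 2 * n * N + 1) := by rw [← pow_add, pow_succ]; ring
      _ ≤ T ^ Eu := two_pow_le_pow hw
  have hHT : Hbig ≤ T ^ (N * (EF * k₀ + Eu + 2)) := by
    have h1 : 1 + WF ^ k₀ * (n * B + 1) ≤ T ^ (EF * k₀ + Eu + 1) := by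
      have hprod : WF ^ k₀ * (n * B + 1) ≤ T ^ (EF * k₀ + Eu) := by
        have hsplit : T ^ (EF * k₀ + Eu) = (T ^ EF) ^ k₀ * T ^ Eu := by rw [pow_add, pow_mul]
        rw [hsplit]
        exact Nat.mul_le_mul (Nat.pow_le_pow_left hWFT _) hnB
      have hpos : 1 ≤ WF ^ k₀ * (n * B + 1) := Nat.one_le_iff_ne_zero.2 (by positivity)
      calc 1 + WF ^ k₀ * (n * B + 1) ≤ 2 * (WF ^ k₀ * (n * B + 1)) := by omega
        _ ≤ T * T ^ (EF * k₀ + Eu) := Nat.mul_le_mul (by omega) hprod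
        _ = T ^ (EF * k₀ + Eu + 1) := by rw [pow_succ, mul_comm]
    rw [hHbig]
    calc 2 ^ N * (1 + WF ^ k₀ * (n * B + 1)) ^ N ≤ T ^ N * (T ^ (EF * k₀ + Eu + 1)) ^ N :=
          Nat.mul_le_mul (two_pow_le_pow hw) (Nat.pow_le_pow_left h1 _)
      _ = T ^ (N * (EF * k₀ + Eu + 2)) := by rw [← pow_mul, ← pow_add]; ring_nf
  have hLT : L ≤ T ^ ((1 + N + N * (EF * k₀ + Eu + 2)) * (3 * N ^ 2 + 3)) := by
    rw [hL, pow_mul]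
    refine Nat.pow_le_pow_left ?_ _
    calc 2 * N * Hbig ≤ T * T ^ N * T ^ (N * (EF * k₀ + Eu + 2)) :=
          Nat.mul_le_mul (Nat.mul_le_mul (by omega) (((Nat.lt_two_pow_self).le).trans (two_pow_le_pow hw))) hHT
      _ = T ^ (1 + N + N * (EF * k₀ + Eu + 2)) := by rw [pow_add, pow_add, pow_one]
  have hE : n * ((1 + N + N * (EF * k₀ + Eu + 2)) * (3 * N ^ 2 + 3)) ≤ 66 * (d ^ (4 * n)) ^ 7 := by
    rw [hNdef, hDdef, hEF, hEu, hk₀]; exact exponent_bound hnd hn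
  have hLnT : L ^ n ≤ T ^ (66 * (d ^ (4 * n)) ^ 7) := by
    calc L ^ n ≤ (T ^ ((1 + N + N * (EF * k₀ + Eu + 2)) * (3 * N ^ 2 + 3))) ^ n :=
          Nat.pow_le_pow_left hLT _
      _ = T ^ (n * ((1 + N + N * (EF * k₀ + Eu + 2)) * (3 * N ^ 2 + 3))) := by
          rw [← pow_mul, mul_comm]
      _ ≤ T ^ (66 * (d ^ (4 * n)) ^ 7) := Nat.pow_le_pow_right hT1 hE
  have hHfin : Hbig ≤ T ^ (66 * (d ^ (4 * n)) ^ 7) := by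
    refine hHT.trans (Nat.pow_le_pow_right hT1 (le_trans ?_ hE))
    have h3 : 1 ≤ 3 * N ^ 2 + 3 := by omega
    calc N * (EF * k₀ + Eu + 2) ≤ (1 + N + N * (EF * k₀ + Eu + 2)) * 1 := by omega
      _ ≤ (1 + N + N * (EF * k₀ + Eu + 2)) * (3 * N ^ 2 + 3) := Nat.mul_le_mul_left _ h3
      _ ≤ n * ((1 + N + N * (EF * k₀ + Eu + 2)) * (3 * N ^ 2 + 3)) := Nat.le_mul_of_pos_left _ hn
  -- conclusion
  refine ⟨Λ, V, g, y, hΛpos, hgirr, hgprim, hgpos, hgy, fun i => ?_, hgdeg.trans hNΩ, fun j => ?_,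
    hΛL.trans hLnT, hHg.trans hHfin, fun j => (hVL j).trans hLnT⟩
  · have : (fun j => (Λ : ℂ)⁻¹ * Polynomial.aeval y (V j)) = z₀ := funext hsolV
    rw [this]; exact hSz₀ i
  · rw [hV]
    dsimp only
    refine (Polynomial.natDegree_C_mul_le _ _).trans ?_
    exact ((hvdeg j).le.trans hgdeg).trans hNΩ

end Core

/-! ### The discharge -/

/-- **Theorem 4.5 of Bürgisser 2000 TCS** — algebraic solutions of small degree and height —
discharging the named fact `algebraicSolution_height_bound` with the constant `a = 132`: for every
system `S` of integer polynomials in `n < d` variables of degree `≤ d` and weight `≤ w` with a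
complex solution there are `λ ∈ ℕ_{>0}`, `v_i ∈ ℤ[Y]`, a primitive irreducible `g ∈ ℤ[Y]` of
positive degree and a root `y` of `g` with `S(λ⁻¹ v(y)) = 0`, `deg g, deg v_i ≤ 132 d^{132 n}` and
`log λ, log wt(g), log wt(v_i) ≤ 132 d^{132 n} log w`. The cases `w ≤ 1` and `n = 0` have the zero
solution (`thm45_of_zero_solution`); the main case is `thm45_core`. [cite: Burgisser2000TCS, Thm. 4.5 p. 82] -/
theorem algebraicSolution_height_bound_holds : algebraicSolution_height_bound := by
  refine ⟨132, fun n s d w S hnd hdeg hwt hsol => ?_⟩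
  have hd1 : (1 : ℝ) ≤ d := by exact_mod_cast (show 1 ≤ d by omega)
  have hA1 : (1 : ℝ) ≤ (132 : ℕ) * (d : ℝ) ^ (132 * n) := by
    have : (1 : ℝ) ≤ (d : ℝ) ^ (132 * n) := one_le_pow₀ hd1
    push_cast; nlinarith
  by_cases hw : w ≤ 1
  · -- weight `≤ 1`: the zero solution
    obtain ⟨z, hz⟩ := hsol
    have h0 : ∀ i, aeval (0 : Fin n → ℂ) (S i) = 0 := fun i =>
      aeval_zero_of_weight_le_one ((hwt i).trans hw) (hz i)
    have hlog : Real.log w = 0 := by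
      interval_cases w <;> simp
    have hB : (0 : ℝ) ≤ (132 : ℕ) * (d : ℝ) ^ (132 * n) * Real.log w := by rw [hlog, mul_zero]
    exact thm45_of_zero_solution S h0 hA1 hB
  push Not at hw
  have hw2 : 2 ≤ w := hw
  have hlogw : 0 ≤ Real.log w := Real.log_nonneg (by exact_mod_cast le_trans one_le_two hw2)
  have hB : (0 : ℝ) ≤ (132 : ℕ) * (d : ℝ) ^ (132 * n) * Real.log w := by positivity
  rcases Nat.eq_zero_or_pos n with hn0 | hn
  · -- no variables: the (empty) zero solution
    subst hn0
    obtain ⟨z, hz⟩ := hsol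
    have h0 : ∀ i, aeval (0 : Fin 0 → ℂ) (S i) = 0 := fun i => by
      have : z = 0 := Subsingleton.elim _ _
      rw [← this]; exact hz i
    exact thm45_of_zero_solution S h0 hA1 hB
  -- the main case
  obtain ⟨lam, v, g, y, hlam, hgirr, hgprim, hgpos, hgy, hsolv, hgdeg, hvdeg, hlamle, hgwt, hvwt⟩ :=
    thm45_core S hnd hn hw2 hdeg hwt hsol
  have hdegR : ((d ^ (4 * n) : ℕ) : ℝ) ≤ (132 : ℕ) * (d : ℝ) ^ (132 * n) := by
    have h1 : ((d ^ (4 * n) : ℕ) : ℝ) ≤ (d : ℝ) ^ (132 * n) := by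
      rw [Nat.cast_pow]
      exact pow_le_pow_right₀ hd1 (by omega)
    have h2 : (0 : ℝ) ≤ (d : ℝ) ^ (132 * n) := by positivity
    push_cast at h1 ⊢; nlinarith
  have hlogR : ∀ X : ℕ, X ≤ (2 * w) ^ (66 * (d ^ (4 * n)) ^ 7) →
      Real.log X ≤ (132 : ℕ) * (d : ℝ) ^ (132 * n) * Real.log w := by
    intro X hX
    refine (log_le_of_le_pow hX hw2).trans ?_
    have h1 : ((66 * (d ^ (4 * n)) ^ 7 : ℕ) : ℝ) ≤ 66 * (d : ℝ) ^ (132 * n) := by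
      push_cast
      rw [← pow_mul]
      exact mul_le_mul_of_nonneg_left (pow_le_pow_right₀ hd1 (by omega)) (by norm_num)
    calc (2 : ℝ) * ((66 * (d ^ (4 * n)) ^ 7 : ℕ) : ℝ) * Real.log w ≤ 2 * (66 * (d : ℝ) ^ (132 * n)) * Real.log w := by
          gcongr
      _ = (132 : ℕ) * (d : ℝ) ^ (132 * n) * Real.log w := by push_cast; ring
  refine ⟨lam, v, g, y, hlam, hgirr, hgprim, hgpos, hgy, hsolv, ?_, fun j => ?_, hlogR lam hlamle,
    hlogR _ hgwt, fun j => hlogR _ (hvwt j)⟩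
  · exact le_trans (by exact_mod_cast hgdeg) hdegR
  · exact le_trans (by exact_mod_cast hvdeg j) hdegR

end Literature.Computability.AlgebraicComplexity
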